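import Literature.NumberTheory.GaloisRepresentations.PatchingLemma
import Literature.NumberTheory.GaloisRepresentations.AbsGaloisOuterConj
import Literature.NumberTheory.GaloisRepresentations.FrobeniusDensity
import Literature.NumberTheory.GaloisRepresentations.AbsIntegersEquiv
import Literature.NumberTheory.Automorphic.ChebotarevArtinRepHolds
import HarnessLib

/-!
# Sorensen's patching lemma for number fields (Lemma 2 as printed), proved

Topic `Literature/NumberTheory/GaloisRepresentations`.  Sequel to `PatchingLemma` (the
group-theoretic core, `SorensenPatching.PatchingDatum.exists_framedRep` / `.unique`): the
number-field statement of C. M. Sorensen, *A patching lemma*, § 1, Lemma 2 (in *Shimura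
Varieties*, LMS Lecture Note Ser. 457 (2020); quoted in full in the module docstring of
`PatchingLemma`), the "lemma 1 of [54]" by which Harris–Lan–Taylor–Thorne (Res. Math. Sci. 3:37
(2016)) deduce their Cor. 7.14 = Thm. A
(`Literature.NumberTheory.Automorphic.HarrisLanTaylorThorne2016.theoremA_existence`) from
their Thm. 7.13.  Everything here is **proved**; the only arithmetic input is Chebotarev's
density theorem, through `absoluteGaloisGroup.frobenius_dense` and the discharged fact
`Literature.NumberTheory.Automorphic.chebotarev_artinRep_holds`.

## Statement and dictionary

* The family `𝓘`: number fields `E i` (`i : ι`, `ι` non-empty) with `Algebra F (E i)`,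
  `IsGalois F (E i)` and `[E i : F]` prime (a Galois extension of prime degree is cyclic, as in
  the source).  `Γ_{E_i} ⊆ Γ_F` is `res(Γ_{E_i})`, the range of the tree's
  `absGaloisRestrict F (E i)` (a closed embedding with open normal image of index `[E i : F]`:
  `isOpen_range_absGaloisRestrict`, `index_range_absGaloisRestrict`,
  `normal_range_absGaloisRestrict`; inverse `absGaloisRangeInv`).
* `S`-general (Def. 1 of the source: "for any finite place `v ∉ S` of `F` there exist
  infinitely many `E ∈ 𝓘` in which `v` splits completely"): hypothesis `hgen` — for `v ∉ S` the
  set of subgroups `res(Γ_{E_i})` with `#{primes of 𝓞_{E_i} over v} = [E_i : F]` is infinite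
  (members are counted through their Galois groups `Γ_{E_i} ⊆ Γ_F`, i.e. as subfields of `F̄`,
  exactly as for a *set* `𝓘` of subextensions).
* (a) "`ρ_E^σ ≃ ρ_E` for all `σ ∈ Gal(E/F)`": hypothesis `ha` — `ρ_i^τ ≃ ρ_i`
  (`FramedGaloisRep.outerConj`, `ContinuousRep.Equiv`) for all `τ ∈ Γ_F` (for `τ ∈ Γ_{E_i}` this
  holds automatically, `FramedGaloisRep.outerConj_absGaloisRestrict`, so it is a condition on
  `τ̄ ∈ Gal(E_i/F)` only).
* (b) "`ρ_E|_{Γ_{EE'}} ≃ ρ_{E'}|_{Γ_{EE'}}`" (`Γ_{EE'} = Γ_E ∩ Γ_{E'}`): hypothesis `hb` — one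
  matrix conjugates `ρ_i(x)` to `ρ_j(y)` whenever `res x = res y`.
* Conclusion: `r : Γ_F → GL_n(k)` continuous with semisimple underlying representation and
  `r|_{Γ_{E_i}} ≃ ρ_i` (`FramedGaloisRep.restrictField`, `ContinuousRep.Equiv`):
  `exists_framedGaloisRep`; uniqueness up to equivalence:
  `nonempty_equiv_of_forall_restrictField` (which only needs that every `v ∉ S` splits
  completely in *some* member).  The coefficient field `k` is any Hausdorff topological field of
  characteristic `0` (the source: `ℚ̄_ℓ`).

## Proof

`datum` packages the family as a `PatchingDatum` on `Γ_F` (representations transported along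
`res⁻¹`; (a) through `FramedRep.exists_eq_conj_of_equiv` and
`absGaloisRestrict_absGaloisOuterConj`).  The two hypotheses of `PatchingDatum.exists_framedRep`
are supplied with `𝓓` = the decomposition groups `D_𝔓 ≤ Γ_F`, `𝔓` a prime of `\bar ℤ_F` above a
place `v ∉ S`: *generality* — only finitely many subgroups of the compact group `Γ_F` contain a
given open subgroup (`finite_setOf_subgroup_le`), so `S`-generality yields a member
`Γ_{E_i} ⊉ U` in which `v` splits completely, and then `D_𝔓 ≤ Γ_{E_i}`
(`decompositionSubgroup_le_range_of_ncard_primesOver_eq`: the image of `D_𝔓` in `Gal(E_i/F)`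
stabilises a prime above `v`, and such stabilisers are trivial by orbit–stabiliser, Mathlib
`Algebra.IsInvariant.orbit_eq_primesOver`, `MulAction.index_stabilizer`); *density* — the
arithmetic Frobenius elements of `Γ_{E_i}` at the primes above the places of `E_i` outside the
finite set of places above `S` are dense (`absoluteGaloisGroup.frobenius_dense`) and restrict
into the `D_𝔓` (`absGaloisRestrict_mem_decompositionSubgroup`).

Not here: the application to Harris–Lan–Taylor–Thorne's Cor. 7.14 (the family
`E_A = E·A`, `A` imaginary quadratic with `p` split, the representations of Thm. 7.13 for the
base changes of `π`, and the verification of (a), (b) from local–global compatibility), which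
needs Thm. 7.13 for every member and quadratic base change at every place.

## References

* C. M. Sorensen, *A patching lemma*, in: Shimura Varieties, LMS Lecture Note Ser. 457
  (2020), 297–305, § 1, Def. 1, Lemma 1, Lemma 2. [Sorensen2020]
* M. Harris, K.-W. Lan, R. Taylor, J. Thorne, *On the rigid cohomology of certain Shimura
  varieties*, Res. Math. Sci. 3:37 (2016), proof of Cor. 7.14. [HarrisLanTaylorThorneRMS2016]
* J. Neukirch, *Algebraic Number Theory* (1999), Ch. I § 9 (decomposition groups, complete
  splitting), Ch. IV § 1. [NeukirchANT1999]
-/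

noncomputable section

open scoped MatrixGroups Matrix NumberField Pointwise
open Field IsDedekindDomain NumberField Topology

namespace Literature.NumberTheory.GaloisRepresentations

namespace SorensenPatching

/-! ### `Γ_M ≅ res(Γ_M)` and the transport of representations -/

section Range

variable (F M : Type*) [Field F] [Field M] [Algebra F M] [CharZero M] [Algebra.IsAlgebraic F M]

/-- The inverse `res(Γ_M) → Γ_M` of the closed embedding `res : Γ_M → Γ_F`
(`isClosedEmbedding_absGaloisRestrict`), as a continuous homomorphism. [folklore] -/
def absGaloisRangeInv : (absGaloisRestrict F M).range →ₜ* absoluteGaloisGroup M where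
  toMonoidHom := (MonoidHom.ofInjective (f := (absGaloisRestrict F M).toMonoidHom)
    (absGaloisRestrict_injective F M)).symm.toMonoidHom
  continuous_toFun := by
    rw [(isClosedEmbedding_absGaloisRestrict F M).isEmbedding.isInducing.continuous_iff]
    have : (absGaloisRestrict F M) ∘ (fun x : (absGaloisRestrict F M).range =>
        (MonoidHom.ofInjective (f := (absGaloisRestrict F M).toMonoidHom)
          (absGaloisRestrict_injective F M)).symm x) = ((↑) : _ → absoluteGaloisGroup F) := by
      funext x
      exact MonoidHom.apply_ofInjective_symm (absGaloisRestrict_injective F M) x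
    exact this ▸ continuous_subtype_val

/-- `res (res⁻¹ x) = x`. [folklore] -/
@[simp] theorem absGaloisRestrict_absGaloisRangeInv (x : (absGaloisRestrict F M).range) :
    absGaloisRestrict F M (absGaloisRangeInv F M x) = x :=
  MonoidHom.apply_ofInjective_symm (absGaloisRestrict_injective F M) x

/-- `res⁻¹ (res σ) = σ`. [folklore] -/
@[simp] theorem absGaloisRangeInv_absGaloisRestrict (σ : absoluteGaloisGroup M) :
    absGaloisRangeInv F M ⟨absGaloisRestrict F M σ, σ, rfl⟩ = σ :=
  absGaloisRestrict_injective F M (by rw [absGaloisRestrict_absGaloisRangeInv])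

/-- `res⁻¹` is surjective. [folklore] -/
theorem absGaloisRangeInv_surjective : Function.Surjective (absGaloisRangeInv F M) :=
  fun σ => ⟨⟨absGaloisRestrict F M σ, σ, rfl⟩, absGaloisRangeInv_absGaloisRestrict F M σ⟩

end Range

/-! ### `res(Γ_M)` for `M/F` finite Galois: index, openness, finiteness of overgroups -/

section Index

variable (F M : Type*) [Field F] [Field M] [Algebra F M]

/-- **`[Γ_F : res(Γ_M)] = [M : F]`** for `M/F` finite Galois: `res(Γ_M)` is the kernel of
`Γ_F → Gal(M/F)` (`absGaloisQuot`, onto).  (The same statement for any finite `M/F` of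
characteristic `0` is `index_range_absGaloisRestrict_eq_finrank` of `ArtinFormalismInductionProofs`
and the index half of `Literature.NumberTheory.Automorphic.isOpen_range_absGaloisRestrict_and_index`;
re-derived here in five lines to keep this file free of the `L`-function imports of those files.)
Ref: Neukirch, *Algebraic Number Theory*, Ch. IV §1. [folklore] -/
theorem index_range_absGaloisRestrict [IsGalois F M] [FiniteDimensional F M] :
    (absGaloisRestrict F M).range.index = Module.finrank F M := by
  have hker : (absGaloisQuot F M).ker = (absGaloisRestrict F M).range := by
    ext τ
    rw [MonoidHom.mem_ker]
    exact absGaloisQuot_eq_one_iff F M τ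
  rw [← hker, Subgroup.index_ker, MonoidHom.range_eq_top.2 (absGaloisQuot_surjective F M),
    Subgroup.card_top]
  exact IsGalois.card_aut_eq_finrank F M

/-- `res(Γ_M)` is open in `Γ_F` for `M/F` finite Galois of characteristic `0` (closed of finite
index). [folklore] -/
theorem isOpen_range_absGaloisRestrict [IsGalois F M] [FiniteDimensional F M] [CharZero M] :
    IsOpen ((absGaloisRestrict F M).range : Set (absoluteGaloisGroup F)) := by
  haveI : (absGaloisRestrict F M).range.FiniteIndex :=
    ⟨by rw [index_range_absGaloisRestrict]; exact Module.finrank_pos.ne'⟩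
  apply Subgroup.isOpen_of_isClosed_of_finiteIndex
  rw [MonoidHom.coe_range]
  exact isClosed_range_absGaloisRestrict F M

variable {F} in
omit [Algebra F M] in
/-- In the compact group `Γ_F` only finitely many subgroups contain a given open subgroup
(they correspond to subgroups of the finite quotient by its normal core). [folklore] -/
theorem finite_setOf_subgroup_le [CharZero F] (U : Subgroup (absoluteGaloisGroup F))
    (hU : IsOpen (U : Set (absoluteGaloisGroup F))) :
    {H : Subgroup (absoluteGaloisGroup F) | U ≤ H}.Finite := by
  haveI : Finite (absoluteGaloisGroup F ⧸ U) := Subgroup.quotient_finite_of_isOpen U hU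
  haveI : U.FiniteIndex := Subgroup.finiteIndex_of_finite_quotient
  set N := U.normalCore with hN
  haveI : N.FiniteIndex := Subgroup.finiteIndex_normalCore U
  haveI : Finite (absoluteGaloisGroup F ⧸ N) := Subgroup.finite_quotient_of_finiteIndex
  haveI : Finite (Subgroup (absoluteGaloisGroup F ⧸ N)) :=
    Finite.of_injective
      (SetLike.coe : Subgroup (absoluteGaloisGroup F ⧸ N) → Set (absoluteGaloisGroup F ⧸ N))
      SetLike.coe_injective
  let φ : {H : Subgroup (absoluteGaloisGroup F) | U ≤ H} → Subgroup (absoluteGaloisGroup F ⧸ N) :=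
    fun H => H.1.map (QuotientGroup.mk' N)
  have hφ : Function.Injective φ := by
    rintro ⟨H, hH⟩ ⟨H', hH'⟩ h
    have hc : ∀ K : Subgroup (absoluteGaloisGroup F), U ≤ K →
        (K.map (QuotientGroup.mk' N)).comap (QuotientGroup.mk' N) = K := fun K hK => by
      rw [Subgroup.comap_map_eq, QuotientGroup.ker_mk', sup_eq_left]
      exact (Subgroup.normalCore_le U).trans hK
    apply Subtype.ext
    change H = H'
    rw [← hc H hH, ← hc H' hH']
    exact congrArg (Subgroup.comap (QuotientGroup.mk' N)) h
  exact Set.finite_coe_iff.1 (Finite.of_injective φ hφ)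

end Index

/-! ### Number fields: infinitely many places; complete splitting; Frobenius elements -/

section Places

/-- A number field has infinitely many finite places (a prime of `𝓞 F` above every rational
prime).  Local copy of `Literature.NumberTheory.Automorphic.infinite_heightOneSpectrum`
(`JacquetLanglandsParts`), to keep the imports light. [folklore] -/
theorem infinite_heightOneSpectrum (F : Type*) [Field F] [NumberField F] :
    Infinite (HeightOneSpectrum (𝓞 F)) := by
  classical
  have hinj : Function.Injective (algebraMap ℤ (𝓞 F)) := (algebraMap ℤ (𝓞 F)).injective_int
  have key : ∀ p : Nat.Primes, ∃ w : HeightOneSpectrum (𝓞 F),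
      w.asIdeal.comap (algebraMap ℤ (𝓞 F)) = Ideal.span {(p : ℤ)} := by
    intro p
    have hp : Prime (p : ℤ) := Nat.prime_iff_prime_int.mp p.2
    haveI : (Ideal.span {(p : ℤ)}).IsPrime := (Ideal.span_singleton_prime hp.ne_zero).mpr hp
    obtain ⟨Q, -, hQ, hQp⟩ := Ideal.exists_ideal_over_prime_of_isIntegral
      (S := 𝓞 F) (Ideal.span {(p : ℤ)}) ⊥
      (by
        rw [← RingHom.ker_eq_comap_bot, (RingHom.injective_iff_ker_eq_bot _).mp hinj]
        exact bot_le)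
    refine ⟨⟨Q, hQ, fun hQbot => hp.ne_zero ?_⟩, hQp⟩
    have hmem : (p : ℤ) ∈ Q.comap (algebraMap ℤ (𝓞 F)) := by
      rw [hQp]
      exact Ideal.mem_span_singleton_self _
    rw [hQbot, Ideal.mem_comap, Ideal.mem_bot, map_eq_zero_iff _ hinj] at hmem
    exact hmem
  choose f hf using key
  refine Infinite.of_injective f fun p q hpq => ?_
  have h := hf p
  rw [hpq, hf q, Ideal.span_singleton_eq_span_singleton, Int.associated_iff_natAbs,
    Int.natAbs_natCast, Int.natAbs_natCast] at h
  exact Subtype.ext h.symm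

variable {F M : Type*} [Field F] [NumberField F] [Field M] [NumberField M] [Algebra F M]

/-- **A completely split place has trivial decomposition groups modulo `Γ_M`.**  If `M/F` is
Galois and the place `v` of `F` has `[M : F]` primes of `𝓞 M` above it (i.e. splits
completely), then every decomposition group `D_𝔓 ≤ Γ_F`, `𝔓 ∣ v` a prime of `\bar ℤ_F`, lies in
`res(Γ_M)`: the image of `D_𝔓` in `Gal(M/F)` stabilises the prime `𝔔 ∩ 𝓞 M` below the prime
`𝔔 = ι(𝔓)` of `\bar ℤ_M`, and stabilisers of primes above a completely split `v` are trivial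
(orbit–stabiliser, `Gal(M/F)` being transitive on the `[M : F]` primes above `v`).
Ref: Neukirch, *Algebraic Number Theory*, Ch. I §9 ("`v` splits completely iff `Z_𝔓 = 1`").
[folklore] -/
theorem decompositionSubgroup_le_range_of_ncard_primesOver_eq [IsGalois F M]
    {v : HeightOneSpectrum (𝓞 F)}
    (hsplit : (v.asIdeal.primesOver (𝓞 M)).ncard = Module.finrank F M)
    {𝔓 : Ideal (absIntegers (𝓞 F) F)} (h𝔓 : 𝔓 ∈ v.primesAbove) :
    𝔓.decompositionSubgroup (absoluteGaloisGroup F) ≤ (absGaloisRestrict F M).range := by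
  intro σ hσ
  rw [Ideal.mem_decompositionSubgroup_iff] at hσ
  rw [← absGaloisQuot_eq_one_iff]
  -- the prime `𝔔 = ι(𝔓)` of `\bar ℤ_M` and the place `w` of `M` below it
  haveI := h𝔓.1
  obtain ⟨𝔔, h𝔔p, h𝔔⟩ := exists_isPrime_comap_absIntegersMap_eq F M 𝔓
  haveI := h𝔔p
  obtain ⟨w, hwv, h𝔔w, hw𝔔⟩ :=
    exists_heightOneSpectrum_of_comap_absIntegersMap_mem_primesAbove (K := F) (M := M)
      (𝔔 := 𝔔) (h𝔔.symm ▸ h𝔓)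
  -- `σ` fixes `𝔓`, so `σ ⋆ 𝔔 = 𝔔` and `σ̄` fixes `w`
  have h1 : outerConjIdeal σ 𝔔 = 𝔔 :=
    comap_absIntegersMap_injective F M (by rw [comap_outerConjIdeal, h𝔔, hσ])
  have h2 : absGaloisQuot F M σ • w.asIdeal = w.asIdeal := by
    have h := under_outerConjIdeal σ 𝔔
    rw [h1, ← hw𝔔] at h
    exact h.symm
  -- the stabiliser of `w` in `Gal(M/F)` is trivial
  haveI : IsGaloisGroup (M ≃ₐ[F] M) (𝓞 F) (𝓞 M) := IsGaloisGroup.of_isFractionRing _ _ _ F M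
  haveI : w.asIdeal.LiesOver v.asIdeal := ⟨hwv.symm⟩
  haveI : v.asIdeal.IsMaximal := v.isMaximal
  have hidx : (MulAction.stabilizer (M ≃ₐ[F] M) w.asIdeal).index = Nat.card (M ≃ₐ[F] M) := by
    rw [MulAction.index_stabilizer, Algebra.IsInvariant.orbit_eq_primesOver (𝓞 F) (𝓞 M)
      (M ≃ₐ[F] M) v.asIdeal w.asIdeal, hsplit, IsGalois.card_aut_eq_finrank]
  have hbot : MulAction.stabilizer (M ≃ₐ[F] M) w.asIdeal = ⊥ := by
    apply Subgroup.eq_bot_of_card_eq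
    have h := (MulAction.stabilizer (M ≃ₐ[F] M) w.asIdeal).card_mul_index
    rw [hidx] at h
    exact (Nat.mul_eq_right Nat.card_pos.ne').1 h
  have hmem : absGaloisQuot F M σ ∈ MulAction.stabilizer (M ≃ₐ[F] M) w.asIdeal := h2
  rwa [hbot, Subgroup.mem_bot] at hmem

set_option synthInstance.maxHeartbeats 80000 in
-- the pointwise `MulAction` of `Γ_M` on the ideals of the subalgebra `\bar ℤ_M` is slow to find
omit [NumberField F] [NumberField M] in
/-- **Frobenius elements of `Γ_M` restrict into decomposition groups of `Γ_F`**: an arithmetic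
Frobenius `σ ∈ Γ_M` at the prime `𝔔` of `\bar ℤ_M` fixes `𝔔`, so `res σ` fixes `ι⁻¹(𝔔)`.
Ref: Neukirch, *Algebraic Number Theory*, Ch. I §9, (9.4)–(9.5). [folklore] -/
theorem absGaloisRestrict_mem_decompositionSubgroup {𝔔 : Ideal (absIntegers (𝓞 M) M)}
    [𝔔.IsPrime] {σ : absoluteGaloisGroup M} (hσ : IsArithFrobAt (𝓞 M) σ 𝔔) :
    absGaloisRestrict F M σ ∈
      (𝔔.comap (absIntegersMap F M)).decompositionSubgroup (absoluteGaloisGroup F) := by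
  rw [Ideal.mem_decompositionSubgroup_iff, ← comap_absIntegersMap_smul,
    MulAction.mem_stabilizer_iff.1 hσ.mem_stabilizer]

end Places

/-! ### Conjugate framed representations are equivalent -/

section Conj

variable {G : Type*} [Group G] [TopologicalSpace G] {A : Type*} [CommRing A] [TopologicalSpace A]
  [IsTopologicalRing A] {n : ℕ}

/-- **Conjugate framed representations have equivalent underlying continuous representations**
(converse of `FramedRep.exists_eq_conj_of_equiv`): if `ρ' = P ρ P⁻¹` then `v ↦ P v` is an
equivalence `ρ ≃ ρ'` of the continuous representations on `Aⁿ`. [folklore] -/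
def _root_.Literature.NumberTheory.GaloisRepresentations.FramedRep.equivOfEqConj
    (ρ ρ' : FramedRep G A n) (P : GL (Fin n) A) (h : ∀ g, ρ' g = P * ρ g * P⁻¹) :
    ContinuousRep.Equiv (FramedRep.toContinuousRep ρ) (FramedRep.toContinuousRep ρ') where
  toLinearMap := Matrix.toLin' (P : Matrix (Fin n) (Fin n) A)
  invFun v := ((P⁻¹ : GL (Fin n) A) : Matrix (Fin n) (Fin n) A) *ᵥ v
  left_inv v := by
    change ((P⁻¹ : GL (Fin n) A) : Matrix (Fin n) (Fin n) A) *ᵥ ((P : Matrix (Fin n) (Fin n) A) *ᵥ v) = v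
    rw [Matrix.mulVec_mulVec, ← Units.val_mul, inv_mul_cancel, Units.val_one, Matrix.one_mulVec]
  right_inv v := by
    change (P : Matrix (Fin n) (Fin n) A) *ᵥ (((P⁻¹ : GL (Fin n) A) : Matrix (Fin n) (Fin n) A) *ᵥ v) = v
    rw [Matrix.mulVec_mulVec, ← Units.val_mul, mul_inv_cancel, Units.val_one, Matrix.one_mulVec]
  isIntertwining' g := by
    apply LinearMap.ext
    intro v
    change (P : Matrix (Fin n) (Fin n) A) *ᵥ (((ρ g : GL (Fin n) A) : Matrix (Fin n) (Fin n) A) *ᵥ v) =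
      ((ρ' g : GL (Fin n) A) : Matrix (Fin n) (Fin n) A) *ᵥ ((P : Matrix (Fin n) (Fin n) A) *ᵥ v)
    rw [h g, Matrix.mulVec_mulVec, Matrix.mulVec_mulVec, Units.val_mul, Units.val_mul, mul_assoc,
      mul_assoc, ← Units.val_mul P⁻¹ P, inv_mul_cancel, Units.val_one, mul_one]
  continuous_toFun := LinearMap.continuous_on_pi _
  continuous_invFun := (LinearMap.continuous_on_pi (Matrix.toLin'
    ((P⁻¹ : GL (Fin n) A) : Matrix (Fin n) (Fin n) A)))

end Conj

/-! ### The patching datum of an `S`-general family and the patching lemma -/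

section Main

variable {F : Type} [Field F] [NumberField F]
  {k : Type*} [Field k] [TopologicalSpace k] [IsTopologicalRing k] {n : ℕ}
  {ι : Type*} (E : ι → Type) [∀ i, Field (E i)] [∀ i, NumberField (E i)]
  [∀ i, Algebra F (E i)] [∀ i, IsGalois F (E i)]

/-- **The patching datum of a family of Galois representations** `ρ_E : Γ_E → GL_n(k)`,
`E` ranging over Galois extensions of `F` of prime degree, satisfying Sorensen's conditions
(a) `ρ_E^τ ≃ ρ_E` (`FramedGaloisRep.outerConj`) and (b) `ρ_E ≃ ρ_{E'}` on
`Γ_E ∩ Γ_{E'} ⊆ Γ_F`: the subgroups `Δ_E = res(Γ_E) ⊴ Γ_F` (open, normal, of index `[E : F]`)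
with the representations `ρ_E ∘ res⁻¹` (`PatchingDatum`). [cite: Sorensen2020, §1 (a), (b)] -/
def datum (hprime : ∀ i, (Module.finrank F (E i)).Prime) (ρ : ∀ i, FramedGaloisRep (E i) k n)
    (hss : ∀ i, (ρ i).toGaloisRep.IsSemisimple)
    (ha : ∀ i (τ : absoluteGaloisGroup F),
      Nonempty (ContinuousRep.Equiv ((ρ i).outerConj τ).toGaloisRep (ρ i).toGaloisRep))
    (hb : ∀ i j, ∃ P : GL (Fin n) k,
      ∀ (x : absoluteGaloisGroup (E i)) (y : absoluteGaloisGroup (E j)),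
        absGaloisRestrict F (E i) x = absGaloisRestrict F (E j) y → ρ j y = P * ρ i x * P⁻¹) :
    PatchingDatum (absoluteGaloisGroup F) k n ι where
  Δ i := (absGaloisRestrict F (E i)).range
  normal i := normal_range_absGaloisRestrict F (E i)
  isOpen i := isOpen_range_absGaloisRestrict F (E i)
  prime i := by
    rw [index_range_absGaloisRestrict]
    exact hprime i
  ρ i := (ρ i).comp (absGaloisRangeInv F (E i))
  semisimple i :=
    (Representation.isSemisimpleRepresentation_comp_iff_of_surjective
      (ρ i).toGaloisRep.toRepresentation (absGaloisRangeInv F (E i)).toMonoidHom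
      (absGaloisRangeInv_surjective F (E i))).2 (hss i)
  conj i g := by
    obtain ⟨e⟩ := ha i g
    obtain ⟨P, hP⟩ := FramedRep.exists_eq_conj_of_equiv _ _ e
    refine ⟨P⁻¹, fun x => ?_⟩
    have hx : absGaloisRangeInv F (E i) ⟨g * x * g⁻¹,
        (normal_range_absGaloisRestrict F (E i)).conj_mem _ x.2 g⟩ =
        absGaloisOuterConj F (E i) g (absGaloisRangeInv F (E i) x) := by
      apply absGaloisRestrict_injective F (E i)
      rw [absGaloisRestrict_absGaloisRangeInv, absGaloisRestrict_absGaloisOuterConj,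
        absGaloisRestrict_absGaloisRangeInv]
    change ρ i (absGaloisRangeInv F (E i) ⟨g * x * g⁻¹, _⟩) =
      P⁻¹ * ρ i (absGaloisRangeInv F (E i) x) * P⁻¹⁻¹
    rw [hx, inv_inv]
    have h := congrArg (fun τ : FramedGaloisRep (E i) k n => τ (absGaloisRangeInv F (E i) x)) hP
    simp only [FramedRep.conj_apply, FramedGaloisRep.outerConj_apply] at h
    rw [h]
    group
  compat i j := by
    obtain ⟨P, hP⟩ := hb i j
    refine ⟨P, fun x hi hj => ?_⟩
    exact hP (absGaloisRangeInv F (E i) ⟨x, hi⟩) (absGaloisRangeInv F (E j) ⟨x, hj⟩)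
      (by rw [absGaloisRestrict_absGaloisRangeInv, absGaloisRestrict_absGaloisRangeInv])

variable [T2Space k] [CharZero k]

/-- **Sorensen's patching lemma (Lemma 2, as printed), proved.**  Let `F` be a number field,
`S` a finite set of finite places of `F`, and `(E i)_{i ∈ ι}` a non-empty family of Galois
extensions of `F` of prime degree which is **`S`-general** (Def. 1 of the source: for every
finite place `v ∉ S` there are infinitely many members — i.e. infinitely many distinct
`Γ_{E_i} ⊆ Γ_F` — in which `v` splits completely, `#{w ∣ v} = [E_i : F]`).  Let
`ρ_i : Γ_{E_i} → GL_n(k)` be continuous representations with semisimple underlying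
representation (`k` any Hausdorff topological field of characteristic `0`, e.g. `ℚ̄_ℓ`) such
that (a) `ρ_i^τ ≃ ρ_i` for all `τ ∈ Γ_F` (`FramedGaloisRep.outerConj`; for `τ ∈ Γ_{E_i}` this is
automatic, so it is the printed "`ρ_E^σ ≃ ρ_E` for all `σ ∈ Gal(E/F)`") and (b) `ρ_i ≃ ρ_j` on
`Γ_{E_i} ∩ Γ_{E_j}` (the printed "`ρ_E|_{Γ_{EE'}} ≃ ρ_{E'}|_{Γ_{EE'}}`", `Γ_{EE'} = Γ_E ∩ Γ_{E'}`),
equivalences written as conjugation by a matrix.  Then there is a continuous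
`r : Γ_F → GL_n(k)` with semisimple underlying representation such that `r|_{Γ_{E_i}} ≃ ρ_i`
for all `i`.  Deduced from the group-theoretic `PatchingDatum.exists_framedRep` with
`𝓓` = the decomposition groups `D_𝔓 ≤ Γ_F` at the primes `𝔓` of `\bar ℤ_F` above the places
`v ∉ S`: `S`-generality gives, for every open `U ≤ Γ_F` (only finitely many subgroups contain
`U`), a member `Γ_{E_i} ⊉ U` in which `v` splits completely, whence `D_𝔓 ≤ Γ_{E_i}`
(`decompositionSubgroup_le_range_of_ncard_primesOver_eq`); and the Frobenius elements of
`Γ_{E_i}` at the primes above the places outside `S`, which lie in the `D_𝔓 ∩ Γ_{E_i}`, are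
dense in `Γ_{E_i}` by Chebotarev's density theorem (`absoluteGaloisGroup.frobenius_dense`,
from `Literature.NumberTheory.Automorphic.chebotarev_artinRep_holds`).
[cite: Sorensen2020, §1 Lemma 2 (existence)] -/
theorem exists_framedGaloisRep [Nonempty ι] (hprime : ∀ i, (Module.finrank F (E i)).Prime)
    (S : Set (HeightOneSpectrum (𝓞 F))) (hS : S.Finite)
    (hgen : ∀ v ∉ S, {H : Subgroup (absoluteGaloisGroup F) |
      ∃ i, H = (absGaloisRestrict F (E i)).range ∧
        (v.asIdeal.primesOver (𝓞 (E i))).ncard = Module.finrank F (E i)}.Infinite)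
    (ρ : ∀ i, FramedGaloisRep (E i) k n) (hss : ∀ i, (ρ i).toGaloisRep.IsSemisimple)
    (ha : ∀ i (τ : absoluteGaloisGroup F),
      Nonempty (ContinuousRep.Equiv ((ρ i).outerConj τ).toGaloisRep (ρ i).toGaloisRep))
    (hb : ∀ i j, ∃ P : GL (Fin n) k,
      ∀ (x : absoluteGaloisGroup (E i)) (y : absoluteGaloisGroup (E j)),
        absGaloisRestrict F (E i) x = absGaloisRestrict F (E j) y → ρ j y = P * ρ i x * P⁻¹) :
    ∃ r : FramedGaloisRep F k n, r.toGaloisRep.IsSemisimple ∧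
      ∀ i, Nonempty (ContinuousRep.Equiv (r.restrictField (E i)).toGaloisRep (ρ i).toGaloisRep) := by
  classical
  set X := datum E hprime ρ hss ha hb with hX
  -- the decomposition groups at the primes above the places outside `S`
  set 𝓓 : Set (Set (absoluteGaloisGroup F)) := {D | ∃ v ∉ S, ∃ 𝔓 ∈ v.primesAbove,
    D = (𝔓.decompositionSubgroup (absoluteGaloisGroup F) : Set (absoluteGaloisGroup F))} with h𝓓
  haveI := infinite_heightOneSpectrum F
  obtain ⟨v₀, hv₀⟩ := hS.exists_notMem
  have h𝓓ne : 𝓓.Nonempty := by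
    obtain ⟨𝔓, h𝔓⟩ := v₀.primesAbove_nonempty
    exact ⟨_, v₀, hv₀, 𝔓, h𝔓, rfl⟩
  -- generality
  have hgen' : ∀ U : Subgroup (absoluteGaloisGroup F), IsOpen (U : Set (absoluteGaloisGroup F)) →
      ∀ D ∈ 𝓓, ∃ i, ¬ U ≤ X.Δ i ∧ D ⊆ X.Δ i := by
    intro U hU D hD
    obtain ⟨v, hv, 𝔓, h𝔓, rfl⟩ := hD
    obtain ⟨H, ⟨i, rfl, hsplit⟩, hHU⟩ :=
      ((hgen v hv).sdiff (finite_setOf_subgroup_le U hU)).nonempty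
    exact ⟨i, hHU, decompositionSubgroup_le_range_of_ncard_primesOver_eq hsplit h𝔓⟩
  -- density (Chebotarev)
  have hdense : ∀ i, (X.Δ i : Set (absoluteGaloisGroup F)) ⊆
      closure (⋃ D ∈ 𝓓, D ∩ X.Δ i) := by
    intro i
    -- the finitely many places of `E i` above `S`
    set Si : Set (HeightOneSpectrum (𝓞 (E i))) := {w | w.under (𝓞 F) ∈ S} with hSi
    have hSifin : Si.Finite :=
      hS.preimage' fun v _ => finite_setOf_under_eq (M := E i) v
    have hd := absoluteGaloisGroup.frobenius_dense Automorphic.chebotarev_artinRep_holds (E i)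
      Si hSifin
    -- Frobenius elements of `Γ_{E i}` outside `Si` restrict into `⋃_{D ∈ 𝓓} D ∩ Δ i`
    have hsub : Set.MapsTo (absGaloisRestrict F (E i)) {σ : absoluteGaloisGroup (E i) |
        ∃ w ∉ Si, ∃ 𝔔 ∈ w.primesAbove, IsArithFrobAt (𝓞 (E i)) σ 𝔔} (⋃ D ∈ 𝓓, D ∩ X.Δ i) := by
      rintro σ ⟨w, hw, 𝔔, h𝔔, hσ⟩
      haveI := h𝔔.1
      have h𝔓 : 𝔔.comap (absIntegersMap F (E i)) ∈ (w.under (𝓞 F)).primesAbove :=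
        comap_absIntegersMap_mem_primesAbove (by rw [HeightOneSpectrum.under_asIdeal]) h𝔔
      simp only [Set.mem_iUnion, Set.mem_inter_iff, exists_prop]
      exact ⟨_, ⟨w.under (𝓞 F), hw, _, h𝔓, rfl⟩, absGaloisRestrict_mem_decompositionSubgroup hσ,
        ⟨σ, rfl⟩⟩
    rintro _ ⟨σ, rfl⟩
    exact map_mem_closure (absGaloisRestrict F (E i)).continuous (hd σ) hsub
  -- patch
  obtain ⟨r, hrss, hr⟩ := X.exists_framedRep 𝓓 h𝓓ne hgen' hdense
  refine ⟨r, hrss, fun i => ?_⟩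
  obtain ⟨P, hP⟩ := hr i
  refine ⟨FramedRep.equivOfEqConj (FramedGaloisRep.restrictField (E i) r) (ρ i) P fun σ => ?_⟩
  have h := hP ⟨absGaloisRestrict F (E i) σ, σ, rfl⟩
  change ρ i (absGaloisRangeInv F (E i) ⟨absGaloisRestrict F (E i) σ, σ, rfl⟩) =
    P * r (absGaloisRestrict F (E i) σ) * P⁻¹ at h
  rwa [absGaloisRangeInv_absGaloisRestrict] at h

/-- **Uniqueness in Sorensen's patching lemma** ("This determines the representation `ρ`
uniquely up to isomorphism"): if every place `v ∉ S` splits completely in some member `E i`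
(e.g. the family is `S`-general), then two continuous `r, r' : Γ_F → GL_n(k)` with semisimple
underlying representations and `r|_{Γ_{E_i}} ≃ ρ_i ≃ r'|_{Γ_{E_i}}` for all `i` are
equivalent: their traces agree on every `Γ_{E_i}`, which contain the decomposition groups and
hence the Frobenius elements at all primes above the places `v ∉ S`, a dense subset of `Γ_F`
(Chebotarev, `absoluteGaloisGroup.frobenius_dense`); then Brauer–Nesbitt
(`exists_conj_of_trace_eq`). [cite: Sorensen2020, §1 Lemma 2 (uniqueness)] -/
theorem nonempty_equiv_of_forall_restrictField (S : Set (HeightOneSpectrum (𝓞 F)))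
    (hS : S.Finite)
    (hcov : ∀ v ∉ S, ∃ i, (v.asIdeal.primesOver (𝓞 (E i))).ncard = Module.finrank F (E i))
    (ρ : ∀ i, FramedGaloisRep (E i) k n) (r r' : FramedGaloisRep F k n)
    (hr : r.toGaloisRep.IsSemisimple) (hr' : r'.toGaloisRep.IsSemisimple)
    (h : ∀ i, Nonempty (ContinuousRep.Equiv (r.restrictField (E i)).toGaloisRep (ρ i).toGaloisRep))
    (h' : ∀ i, Nonempty (ContinuousRep.Equiv (r'.restrictField (E i)).toGaloisRep (ρ i).toGaloisRep)) :
    Nonempty (ContinuousRep.Equiv r.toGaloisRep r'.toGaloisRep) := by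
  -- traces agree on every `res(Γ_{E i})`
  have htr : ∀ i (σ : absoluteGaloisGroup (E i)),
      (mat r (absGaloisRestrict F (E i) σ)).trace = (mat r' (absGaloisRestrict F (E i) σ)).trace := by
    intro i σ
    obtain ⟨P, hP⟩ := FramedRep.exists_eq_conj_of_equiv _ _ (Classical.choice (h i))
    obtain ⟨P', hP'⟩ := FramedRep.exists_eq_conj_of_equiv _ _ (Classical.choice (h' i))
    have e := (congrArg (fun τ : FramedGaloisRep (E i) k n => τ σ) hP).symm.trans
      (congrArg (fun τ : FramedGaloisRep (E i) k n => τ σ) hP')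
    simp only [FramedRep.conj_apply, FramedGaloisRep.restrictField_apply] at e
    -- `P r(σ) P⁻¹ = P' r'(σ) P'⁻¹`
    have e' : r' (absGaloisRestrict F (E i) σ) =
        P'⁻¹ * (P * r (absGaloisRestrict F (E i) σ) * P⁻¹) * P' := by
      rw [e]
      group
    change _ = ((r' (absGaloisRestrict F (E i) σ) : GL (Fin n) k) : Matrix (Fin n) (Fin n) k).trace
    rw [e', Units.val_mul, Units.val_mul, Matrix.trace_units_conj', Units.val_mul, Units.val_mul,
      Matrix.trace_units_conj]
  -- hence on the Frobenius elements at the primes above the places outside `S`, a dense set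
  have hsub : {σ : absoluteGaloisGroup F | ∃ v ∉ S, ∃ 𝔓 ∈ v.primesAbove,
      IsArithFrobAt (𝓞 F) σ 𝔓} ⊆ {σ | (mat r σ).trace = (mat r' σ).trace} := by
    rintro σ ⟨v, hv, 𝔓, h𝔓, hσ⟩
    obtain ⟨i, hsplit⟩ := hcov v hv
    haveI := h𝔓.1
    have hmem : σ ∈ 𝔓.decompositionSubgroup (absoluteGaloisGroup F) := hσ.mem_stabilizer
    obtain ⟨τ, rfl⟩ := decompositionSubgroup_le_range_of_ncard_primesOver_eq hsplit h𝔓 hmem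
    exact htr i τ
  have hcl : IsClosed {σ : absoluteGaloisGroup F | (mat r σ).trace = (mat r' σ).trace} :=
    isClosed_eq (FramedRep.continuous_trace r) (FramedRep.continuous_trace r')
  have hall : ∀ σ, (mat r σ).trace = (mat r' σ).trace := fun σ =>
    hcl.closure_subset_iff.2 hsub
      (absoluteGaloisGroup.frobenius_dense Automorphic.chebotarev_artinRep_holds F S hS σ)
  obtain ⟨P, hP⟩ := exists_conj_of_trace_eq r r' hr hr' hall
  exact ⟨FramedRep.equivOfEqConj r r' P hP⟩

end Main

end SorensenPatching

end Literature.NumberTheory.GaloisRepresentations
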